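import Literature.Computability.Cryptography.OrderFindingPostCF
import Literature.Computability.Cryptography.OrderFindingPostCounts
import Literature.Computability.Cryptography.OrderFindingPostRefine
import Literature.Computability.Complexity.StackBricksStrings
import HarnessLib

/-!
# Shor's order-finding post-processor is polynomial time, IV: `lcm` and assembly
(`orderFindingPost_mem_FP` discharged)

Family `PQC` (trunk `CryptoQuantFine`); closes the plan of `OrderFindingPostCounts.lean` for the
programming fact `orderFindingPost_mem_FP` of `ShorOrderFindingQuantum.lean` (one of the seven
named facts of `ShorTheoremAssembly.FACT_mem_BQP_of_facts`): the classical post-processor of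
Kitaev's order-finding experiment — block counts and quadrant bits (`OFPostA1.stageA1`), Kitaev's
refinement in integers (`OFPostA2.stageA2`), and here **stage B**: for each of the four trials the
continued-fraction scan `OFPostB.cfScanF` of `OrderFindingPostCF.lean` on `(A_t, D = 2^{L+2})`
with `q = 4^ℓ`, `K = 2L + 7` rounds (Shor 1997, §5, p. 18 of arXiv v2: "this fraction can be found in polynomial time by
using a continued fraction expansion"), then the `lcm` of the four candidates (Knill's remark,
Shor 1997, §5, p. 15) and its numeral.

* glue: `getD_kapBits`/`kapOf_kapBits` (the quadrant bits written by stage A1 are the ones the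
  specification reads off the controls, `OFPostCF.cnt_readControls`), `refineNat_congr`,
  `aOf_kapBits`;
* stage B: `q2F`, `dF`, `uKF` (the constants `2q`, `D`, `1^K` from `1^ℓ`), `candF`, `lcmF`,
  `stageB`, `stageB_mem_FP`, `stageB_apply`;
* **`orderFindingPost_eq_comp : orderFindingPost = stageB ∘ stageA2 ∘ stageA1`** (from the closed
  form `OFPostCF.orderFindingPost_eq`) and **`orderFindingPost_mem_FP_holds`**.

## References

* P. W. Shor, *Polynomial-time algorithms for prime factorization and discrete logarithms on a
  quantum computer*, SIAM J. Comput. 26 (1997) 1484–1509, §5 (pp. 15–18 of arXiv:quant-ph/9508027v2).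
* A. Yu. Kitaev, *Quantum measurements and the Abelian Stabilizer Problem*, arXiv:quant-ph/9511026
  (1995), §3 (Lemma 10, Thm. 1).
* S. Arora, B. Barak, *Computational Complexity: A Modern Approach*, CUP 2009, §1.3.
-/

noncomputable section

namespace Literature.Computability.Cryptography

namespace OFPostB

open _root_.Computability Polynomial Complexity Complexity.Brick OFPostCF OFPostA1 OFPostA2 Kitaev1995 ShorFP Finset

attribute [-simp] Brick.nthF_zero Brick.sndPow_zero

/-! ### The quadrant bits of stage A1 are the ones of the specification -/

/-- Indexing a `flatMap` of pieces of constant length. [folklore] -/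
theorem getElem?_flatMap_range {α : Type*} (f : ℕ → List α) (c : ℕ) (hf : ∀ i, (f i).length = c) :
    ∀ (m i r : ℕ), i < m → r < c → ((List.range m).flatMap f)[c * i + r]? = (f i)[r]?
  | 0, i, r, hi, _ => absurd hi (Nat.not_lt_zero i)
  | m + 1, i, r, hi, hr => by
    have hlen : ∀ m, ((List.range m).flatMap f).length = c * m := by
      intro m
      induction m with
      | zero => simp
      | succ m ih => rw [List.range_succ, List.flatMap_append, List.length_append, ih]; simp [hf]; ring
    rw [List.range_succ, List.flatMap_append]
    rcases Nat.lt_succ_iff_lt_or_eq.1 hi with h | rfl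
    · rw [List.getElem?_append_left (by rw [hlen]; nlinarith), getElem?_flatMap_range f c hf m i r h hr]
    · rw [List.getElem?_append_right (by rw [hlen]; omega), hlen]
      simp

/-- **The test bit `(t, l, σ)` of `kapBits` sits at position `2Lt + 2l + σ`.** [folklore] -/
theorem getD_kapBits (ℓ : ℕ) (y : List Bool) {t l : ℕ} (ht : t < 4) (hl : l < numLevels ℓ) (b : Bool) :
    (kapBits ℓ y).getD (2 * numLevels ℓ * t + 2 * l + b.toNat) false = testBit ℓ y t l b := by
  rw [List.getD_eq_getElem?_getD, kapBits, show 2 * numLevels ℓ * t + 2 * l + b.toNat = (2 * numLevels ℓ) * t + (2 * l + b.toNat) by ring,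
    getElem?_flatMap_range _ (2 * numLevels ℓ) (fun i => ?_) 4 t _ ht (by have := Bool.toNat_le b; omega),
    getElem?_flatMap_range _ 2 (fun i => rfl) (numLevels ℓ) l b.toNat hl (by cases b <;> simp)]
  · cases b <;> simp
  · have := getElem?_flatMap_range (fun l => [testBit ℓ y i l false, testBit ℓ y i l true]) 2 (fun _ => rfl)
    -- length of the inner `flatMap`
    clear this
    induction numLevels ℓ with
    | zero => simp
    | succ L ih => rw [List.range_succ, List.flatMap_append, List.length_append, ih]; simp; ring

/-- **The quadrant numerators read by stage A2 are those of the specification** (block counts of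
the controls, `cnt_readControls`). [cite: Kitaev1995, §3 (before Lemma 9)] -/
theorem kapOf_kapBits (ℓ : ℕ) (y : List Bool) (t : Fin numTrials) {l : ℕ} (hl : l < numLevels ℓ) :
    kapOf (numLevels ℓ) (kapBits ℓ y) t l = levelNum ℓ (readControls ℓ y) t l := by
  have ht : (t : ℕ) < 4 := t.isLt
  have h0 := getD_kapBits ℓ y ht hl false
  have h1 := getD_kapBits ℓ y ht hl true
  simp only [Bool.toNat_false, add_zero, Bool.toNat_true] at h0 h1
  rw [kapOf, h0, h1, levelNum, dif_pos hl, cnt_readControls, cnt_readControls]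
  rfl

/-- The integer refinement only reads the level numerators `κ l`, `l ≤ L - 1`. [folklore] -/
theorem refineNat_congr {κ κ' : ℕ → ℕ} {L : ℕ} (h : ∀ l, l ≤ L - 1 → κ l = κ' l) :
    ∀ d, refineNat κ L d = refineNat κ' L d
  | 0 => by simp [refineNat, h]
  | d + 1 => by simp only [refineNat, refineNat_congr h d, h (L - 1 - (d + 1)) (Nat.sub_le _ _)]

/-- **The refined numerators of stage A2 are those of the specification.** [cite: Kitaev1995, §3 Lemma 10] -/
theorem aOf_kapBits (ℓ : ℕ) (y : List Bool) (t : Fin numTrials) :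
    aOf (numLevels ℓ) (kapBits ℓ y) t = refineNat (levelNum ℓ (readControls ℓ y) t) (numLevels ℓ) (numLevels ℓ - 1) :=
  refineNat_congr (fun l hl => kapOf_kapBits ℓ y t (by unfold numLevels at *; omega)) _

/-! ### The constants of stage B from the unary length `1^ℓ` -/

/-- The ruler `1^{2ℓ+1}`. [folklore] -/
def r1F : List Bool → List Bool := List.cons true ∘ onesMulFn 2
/-- The ruler `1^{2ℓ+3}`. [folklore] -/
def r3F : List Bool → List Bool := List.cons true ∘ List.cons true ∘ r1F
/-- `2q = 2 · 4^ℓ = 2^{2ℓ+1}` as a numeral. [cite: Shor1997, §5 (q with n² ≤ q < 2n²; here q = 4^ℓ)] -/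
def q2F : List Bool → List Bool := pow2F ∘ fanoutFn r1F (lenBinF ∘ r1F)
/-- `D = 2^{L+2} = 2^{2ℓ+3}` as a numeral. [cite: Kitaev1995, §3 Thm 1 (precision of the phase estimate)] -/
def dF : List Bool → List Bool := pow2F ∘ fanoutFn r3F (lenBinF ∘ r3F)
/-- `1^K`, `K = 2L + 7 = 4ℓ + 9`, the round count of the scan. [folklore] -/
def uKF : List Bool → List Bool :=
  List.cons true ∘ List.cons true ∘ List.cons true ∘ List.cons true ∘ List.cons true ∘ List.cons true ∘ List.cons true ∘
    List.cons true ∘ List.cons true ∘ onesMulFn 4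

/-- Length of the ruler `r1F`. [folklore] -/
theorem length_r1F (u : List Bool) : (r1F u).length = 2 * u.length + 1 := by
  simp [r1F, onesMulFn]

/-- Length of the ruler `r3F`. [folklore] -/
theorem length_r3F (u : List Bool) : (r3F u).length = 2 * u.length + 3 := by
  simp [r3F, r1F, onesMulFn]

/-- Value of `q2F`. [folklore] -/
theorem q2F_apply (u : List Bool) : q2F u = encodeNat (2 * 4 ^ u.length) := by
  have h : 2 * 4 ^ u.length = 2 ^ (2 * u.length + 1) := by
    rw [pow_succ, pow_mul]; norm_num; ring
  rw [h, q2F, Function.comp_apply, fanoutFn_apply, Function.comp_apply, lenBinF_apply, pow2F_apply le_rfl, length_r1F]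

/-- Value of `dF`. [folklore] -/
theorem dF_apply (u : List Bool) : dF u = encodeNat (2 ^ (2 * u.length + 3)) := by
  rw [dF, Function.comp_apply, fanoutFn_apply, Function.comp_apply, lenBinF_apply, pow2F_apply le_rfl, length_r3F]

/-- Length of `uKF`. [folklore] -/
theorem length_uKF (u : List Bool) : (uKF u).length = 4 * u.length + 9 := by
  simp [uKF, onesMulFn]

/-- `r1F ∈ FP`. [folklore] -/
theorem r1F_mem_FP : r1F ∈ FP := comp_mem_FP (cons_mem_FP true) (onesMulFn_mem_FP 2)
/-- `r3F ∈ FP`. [folklore] -/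
theorem r3F_mem_FP : r3F ∈ FP := comp_mem_FP (cons_mem_FP true) (comp_mem_FP (cons_mem_FP true) r1F_mem_FP)
/-- `q2F ∈ FP`. [folklore] -/
theorem q2F_mem_FP : q2F ∈ FP := comp_mem_FP pow2F_mem_FP (fanoutFn_mem_FP r1F_mem_FP (comp_mem_FP lenBinF_mem_FP r1F_mem_FP))
/-- `dF ∈ FP`. [folklore] -/
theorem dF_mem_FP : dF ∈ FP := comp_mem_FP pow2F_mem_FP (fanoutFn_mem_FP r3F_mem_FP (comp_mem_FP lenBinF_mem_FP r3F_mem_FP))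
/-- `uKF ∈ FP`. [folklore] -/
theorem uKF_mem_FP : uKF ∈ FP :=
  comp_mem_FP (cons_mem_FP true) (comp_mem_FP (cons_mem_FP true) (comp_mem_FP (cons_mem_FP true) (comp_mem_FP (cons_mem_FP true)
    (comp_mem_FP (cons_mem_FP true) (comp_mem_FP (cons_mem_FP true) (comp_mem_FP (cons_mem_FP true) (comp_mem_FP (cons_mem_FP true)
      (comp_mem_FP (cons_mem_FP true) (onesMulFn_mem_FP 4)))))))))

/-! ### Stage B -/

/-- The candidate of the trial whose refined numerator is read by `AF`, on
`v = ⟨N, ⟨1^ℓ, ⟨A₀, ⟨A₁, ⟨A₂, A₃⟩⟩⟩⟩⟩`: the scan on `⟨⟨N, ⟨2q, ⟨A_t, D⟩⟩⟩, 1^K⟩`. [cite: Shor1997, §5 (continued fraction recovery of d/r)] -/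
def candF (AF : List Bool → List Bool) : List Bool → List Bool :=
  cfScanF ∘ fanoutFn (fanoutFn (nthF 0) (fanoutFn (q2F ∘ nthF 1) (fanoutFn AF (dF ∘ nthF 1)))) (uKF ∘ nthF 1)

/-- `candF AF ∈ FP` for `AF ∈ FP`. [folklore] -/
theorem candF_mem_FP {AF : List Bool → List Bool} (h : AF ∈ FP) : candF AF ∈ FP :=
  comp_mem_FP cfScanF_mem_FP (fanoutFn_mem_FP (fanoutFn_mem_FP (nthF_mem_FP 0) (fanoutFn_mem_FP (comp_mem_FP q2F_mem_FP (nthF_mem_FP 1))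
    (fanoutFn_mem_FP h (comp_mem_FP dF_mem_FP (nthF_mem_FP 1))))) (comp_mem_FP uKF_mem_FP (nthF_mem_FP 1)))

/-- The candidate of Shor's recovery for numerator `a` on instances of length `ℓ`:
`cfCandidate n 4^ℓ a 2^{2ℓ+3} (4ℓ+9)`. [cite: Shor1997, §5 (continued fraction recovery of d/r)] -/
def cand (n ℓ a : ℕ) : ℕ := cfCandidate n (4 ^ ℓ) a (2 ^ (2 * ℓ + 3)) (4 * ℓ + 9)

/-- **Value of `candF`** on a record with `N = encodeNat n`, `|U| = ℓ` and `AF v = encodeNat a`. [folklore] -/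
theorem candF_apply {AF : List Bool → List Bool} {n a : ℕ} {u rest : List Bool}
    (hA : AF (boolPair (encodeNat n) (boolPair u rest)) = encodeNat a) :
    candF AF (boolPair (encodeNat n) (boolPair u rest)) = encodeNat (cand n u.length a) := by
  simp only [candF, Function.comp_apply, fanoutFn_apply, nthF_zero_boolPair, nthF_succ_boolPair, hA, q2F_apply, dF_apply]
  rw [← xrec, cfScanF_apply, length_uKF, cand]

/-- `lcm ⟨a, b⟩ = a b / gcd(a, b)`. [folklore] -/
def lcmF : List Bool → List Bool := divFn ∘ fanoutFn prodFn gcdFn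

/-- Value of `lcmF`. [folklore] -/
@[simp] theorem lcmF_boolPair (a b : List Bool) : lcmF (boolPair a b) = encodeNat (Nat.lcm (bitsToNat a) (bitsToNat b)) := by
  simp [lcmF, Nat.lcm]

/-- `lcmF ∈ FP`. [folklore] -/
theorem lcmF_mem_FP : lcmF ∈ FP := comp_mem_FP divFn_mem_FP (fanoutFn_mem_FP prodFn_mem_FP gcdFn_mem_FP)

/-- **Stage B of the post-processor**: the `lcm` of the four candidates, as a numeral.
[cite: Shor1997, §5 p.15 (Knill: lcm of the candidates); Kitaev1995, §4] -/
def stageB : List Bool → List Bool :=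
  lcmF ∘ fanoutFn (candF (nthF 2)) (lcmF ∘ fanoutFn (candF (nthF 3)) (lcmF ∘ fanoutFn (candF (nthF 4)) (candF (sndPow 4))))

/-- **`stageB ∈ FP`.** [cite: AroraBarak2009, §1.3 (closure of polynomial time under composition and bounded loops)] -/
theorem stageB_mem_FP : stageB ∈ FP :=
  comp_mem_FP lcmF_mem_FP (fanoutFn_mem_FP (candF_mem_FP (nthF_mem_FP 2)) (comp_mem_FP lcmF_mem_FP
    (fanoutFn_mem_FP (candF_mem_FP (nthF_mem_FP 3)) (comp_mem_FP lcmF_mem_FP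
      (fanoutFn_mem_FP (candF_mem_FP (nthF_mem_FP 4)) (candF_mem_FP (sndPow_mem_FP 4)))))))

/-- **Value of stage B.** [folklore] -/
theorem stageB_apply (n a₀ a₁ a₂ a₃ : ℕ) (u : List Bool) :
    stageB (boolPair (encodeNat n) (boolPair u (boolPair (encodeNat a₀) (boolPair (encodeNat a₁) (boolPair (encodeNat a₂) (encodeNat a₃)))))) =
      encodeNat (Nat.lcm (cand n u.length a₀) (Nat.lcm (cand n u.length a₁) (Nat.lcm (cand n u.length a₂) (cand n u.length a₃)))) := by
  have h0 := candF_apply (AF := nthF 2) (n := n) (a := a₀) (u := u)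
    (rest := boolPair (encodeNat a₀) (boolPair (encodeNat a₁) (boolPair (encodeNat a₂) (encodeNat a₃)))) (by simp)
  have h1 := candF_apply (AF := nthF 3) (n := n) (a := a₁) (u := u)
    (rest := boolPair (encodeNat a₀) (boolPair (encodeNat a₁) (boolPair (encodeNat a₂) (encodeNat a₃)))) (by simp)
  have h2 := candF_apply (AF := nthF 4) (n := n) (a := a₂) (u := u)
    (rest := boolPair (encodeNat a₀) (boolPair (encodeNat a₁) (boolPair (encodeNat a₂) (encodeNat a₃)))) (by simp)
  have h3 := candF_apply (AF := sndPow 4) (n := n) (a := a₃) (u := u)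
    (rest := boolPair (encodeNat a₀) (boolPair (encodeNat a₁) (boolPair (encodeNat a₂) (encodeNat a₃)))) (by simp)
  simp only [stageB, Function.comp_apply, fanoutFn_apply, h0, h1, h2, h3, lcmF_boolPair, bitsToNat_encodeNat]

/-! ### Assembly -/

/-- Trial `i < 4` as an element of `Fin numTrials`. [folklore] -/
abbrev tr (i : ℕ) (h : i < 4 := by decide) : Fin numTrials := ⟨i, h⟩

/-- The `lcm` over the four trials. [folklore] -/
theorem univ_lcm_eq (f : Fin numTrials → ℕ) :
    univ.lcm f = Nat.lcm (f (tr 0)) (Nat.lcm (f (tr 1)) (Nat.lcm (f (tr 2)) (f (tr 3)))) := by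
  have hu : (univ : Finset (Fin numTrials)) = {tr 0, tr 1, tr 2, tr 3} := by decide
  rw [hu, lcm_insert, lcm_insert, lcm_insert, lcm_singleton, normalize_eq]
  rfl

/-- **The post-processor is the composite of the three stages.** [cite: Kitaev1995, §3 (Lemma 10, Thm 1) and §4; Shor1997, §5] -/
theorem orderFindingPost_eq_comp : orderFindingPost = stageB ∘ stageA2 ∘ stageA1 := by
  funext z
  rw [orderFindingPost_eq, Function.comp_apply, Function.comp_apply]
  set w := (boolUnpair z).1 with hw
  set y := (boolUnpair z).2 with hy
  have hA1 : stageA1 z = boolPair (encodeNat (decodeNat (boolUnpair w).2)) (boolPair (ones w.length) (kapBits w.length y)) := by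
    rw [stageA1, encodeNat_decodeNat_eq_canonBits]
  have hA2 : stageA2 (stageA1 z) = boolPair (encodeNat (decodeNat (boolUnpair w).2)) (boolPair (ones w.length)
      (boolPair (encodeNat (aOf (numLevels w.length) (kapBits w.length y) 0)) (boolPair (encodeNat (aOf (numLevels w.length) (kapBits w.length y) 1))
        (boolPair (encodeNat (aOf (numLevels w.length) (kapBits w.length y) 2)) (encodeNat (aOf (numLevels w.length) (kapBits w.length y) 3)))))) := by
    rw [hA1]
    simp [stageA2]
  rw [hA2, stageB_apply, univ_lcm_eq]
  simp only [List.length_replicate]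
  have e0 := aOf_kapBits w.length y (tr 0)
  have e1 := aOf_kapBits w.length y (tr 1)
  have e2 := aOf_kapBits w.length y (tr 2)
  have e3 := aOf_kapBits w.length y (tr 3)
  simp only [tr] at e0 e1 e2 e3
  rw [e0, e1, e2, e3]
  have hq : qOf w.length = 4 ^ w.length := by rw [qOf, pow_mul]; norm_num
  have hD : numLevels w.length + 2 = 2 * w.length + 3 := by rw [numLevels]
  have hK : 2 * (numLevels w.length + 3) + 1 = 4 * w.length + 9 := by rw [numLevels]; ring
  simp only [cand, hq, hD, hK]

/-- **Discharge of the programming fact `orderFindingPost_mem_FP`**: the classical post-processor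
of Kitaev's order-finding family is polynomial time — block counts (`stageA1_mem_FP`), integer
refinement (`stageA2_mem_FP`), continued fractions and `lcm` (`stageB_mem_FP`), composed
(`comp_mem_FP`). Shor (1997, §5): the fraction "can be found in polynomial time by using a
continued fraction expansion". [cite: Shor1997, §5 (continued fractions in polynomial time); Kitaev1995, §3 Thm 1] -/
theorem _root_.Literature.Computability.Cryptography.orderFindingPost_mem_FP_holds : orderFindingPost_mem_FP := by
  rw [orderFindingPost_mem_FP, orderFindingPost_eq_comp]
  exact comp_mem_FP stageB_mem_FP (comp_mem_FP stageA2_mem_FP stageA1_mem_FP)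

end OFPostB

end Literature.Computability.Cryptography

end
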